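import Literature.NumberTheory.EllipticCurves.RankinSelbergHeckeContinuation
import Literature.NumberTheory.GaloisRepresentations.CMTypeHeckeCharacter
import Literature.NumberTheory.EllipticCurves.HeegnerPointsImaginaryQuadraticProofs
import Literature.NumberTheory.EllipticCurves.CuspFormLFunction
import Literature.NumberTheory.EllipticCurves.CastellaGrossiSkinner2025.TwoVariablePAdicLFunctionII
import Literature.NumberTheory.EllipticCurves.YanZhu2026.GreenbergMainTheorems
import Literature.NumberTheory.EllipticCurves.DeShalit1987.KatzMeasureUnitTwistPair
import Literature.NumberTheory.EllipticCurves.DeShalit1987.KatzMeasureFromDistribution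
import Literature.NumberTheory.EllipticCurves.ZpExtensionDecompositionOpenImageProofs
import Literature.NumberTheory.GaloisRepresentations.AbsGaloisOuterConj
import Literature.NumberTheory.EllipticCurves.DeShalit1987.LMeasureAvatarRigidity
import Literature.NumberTheory.EllipticCurves.DeShalit1987.KatzPAdicLValue
import Literature.NumberTheory.EllipticCurves.DeShalit1987.KatzMeasurePointTransport
import Literature.NumberTheory.EllipticCurves.DeShalit1987.AvatarArtinLift
import Literature.NumberTheory.GaloisRepresentations.HeckeCharacterWeakApproximation
import Literature.NumberTheory.GaloisRepresentations.HeckeCharacterInfinityTypeUnique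
import Literature.NumberTheory.GaloisRepresentations.HeckeCharacterMuAlgGalConjTwist
import Literature.NumberTheory.GaloisRepresentations.HeckeCharacterBaseChangeGaloisConjProofs
import Literature.NumberTheory.GaloisRepresentations.IntegralGaloisActionProofs
import HarnessLib

/-!
# `SplitsliceSeams` v1.1 — crux `TwoVariableEulerSystemDivisibility` (stmt-BirchSwinnertonDyer-20728), route
`SignedBaseChange`, line of record `Lines/ratlift.lean` v5.4 (sha16 `0bd9dcd5125037c5`, 130 315 B — UNTOUCHED);
companion of `SplitsliceFam.lean` v1.9 (`15642d3b8a3c`) §F12–§F13 and of the annex `Lines/ratlift_annex_g45.md` rev 5/6 §8–§10.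

v1.1 (over v1.0 `6236b467da53`, decls 1–22 byte-identical): section `ValueConditionsTwoThree` — the THREE VALUE CONDITIONS
(S4′) of `SplitsliceFam.rich_of_two_characters` (`hB₁`, `hA₁`, `hB₂`) DISCHARGED IN KERNEL for an adapted generator pair over an
imaginary quadratic `K` (`valueConditions_of_adaptedPair`): (II)-1 `rB(γ₁⁻¹) = 1` from the Hecke identity `(B∘ρ̄)·B = 1`
(v1.0 `avatarValueAt_inv_eq_one_of_galConj_mul_self_eq_one`); (II)-2 powers of `rA(γ₁⁻¹)` injective for type `(a₁, a₂)`,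
`a₁ + a₂ ≠ 0` (`injective_pow_avatarValueAt_inv_of_add_ne_zero`: the conjugate product `(A∘ρ̄)·A` has avatar
`rA ⊗ det(rA∘θ_ρ)` with values `rA(γ₁)², 1` at `γ₁, γ₂` and type `(a₁+a₂)(1,1)`); (II)-3 powers of `rB(γ₂⁻¹)` injective for
type `≠ (0,0)` given `rB(γ₁⁻¹) = 1` (`injective_pow_avatarValueAt_of_apply_eq_one`). Engine: PAIR DETERMINATION
(`avatarValueAt_eq_one_of_generators`: an avatar through the pair with values `1` at `γ₁, γ₂` is trivial — continuity of the
descended character on `ℤ_p²` + density of `ℕ²`, tree `isContinuousChar₂_pairChar`) + HECKE RIGIDITY (`eq_one_of_avatar_trivial`: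
trivial avatar ⇒ trivial Frobenius values off `p` ⇒ `φ = 1`, tree `IsPAdicAvatarOutside.avatarValueAt_eq_of_isArithFrobAt` +
`eq_one_of_eventually_valueAtUniformizer_eq_one`) + TYPE SEPARATION (tree `HasInfinityType.eq_of_isTotallyComplex`). No
Hodge–Tate weights, no norm-character avatar. RESIDUE of annex §9 (vi-a) after v1.1: (I) EXISTENCE of `A, B, rA, rB` with the
Hecke identity (tree producers (r1)+(r2)) and (III′) = SEAM 1's level pin + the two named analytic facts.

WHAT THIS FILE IS. The two SEAMS of the frame's per-grid-point auxiliary datum (S2) of §F12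
(`rich_of_supply` / `rich_of_two_characters`, binder `haux`):
`∃ θ L, IsCMNewformOf (ξ / N^{m+1}) θ ∧ Differentiable ℂ L ∧ ∀ s, m + n + 3 < re s → L s = rankinSelbergEulerProductHecke f ξ s`
for an everywhere-unramified `ξ` of infinity type `(−(m+1), n+1)` — reduced IN KERNEL to the tree's two NAMED PUBLISHED
facts `jacquet1972_functionalEquation_rankinSelbergHecke_cone` (Jacquet 1972 / Li 1979, `RankinSelbergHeckeContinuation.lean`)
and `ModularForms.Ribet1977_cmNewform_of_heckeCharacter` (Hecke–Shimura–Ribet, `CMNewformOfHeckeCharacter.lean`) PLUS ONE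
statement-shaped hypothesis, the LEVEL PIN `hpin` (Miyake 2006 Thm. 4.8.2 = Köhler 2011 Thm. 5.1: `θ_k(ξ, z) ∈ M_k(Γ₀(|D|·N(𝔪)), χ)`,
a cusp form for `k ≥ 2`, a NEWFORM for primitive `ξ`; Ribet 1977 Thm. (3.4) + Remark (3.5); so a conductor-1 character of `K`
has its CM newform at level `|d_K|` — the tree's fact `Ribet1977_cmNewform_of_heckeCharacter` leaves the level existential, its
own `TODO(general form)`; typing the pinned level is a Literature debt, not research).
* SEAM 2 (conjugate cone) — DISCHARGED: `rankinSelbergEulerProductHecke_galConj` (`L(f/K, φ ∘ σ, s) = L(f/K, φ, s)` for every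
  `σ ∈ Aut(K/F₀)`, all `s`: the `tprod` reindexed by `v ↦ σ • v`, local factors matched by `heckeValueExtZero_galConj` and
  `HeightOneSpectrum.absNorm_algEquiv_smul`), whence `exists_entire_of_conjugateCone`: the fact applied to `ξ ∘ c`
  (type `(n+1, −(m+1))`, `HasInfinityType.galConj_complexConj`) continues `L(f/K, ξ, s)` from `re s > n + 3 ⊇ re s > m + n + 3`.
* SEAM 1 (CM newform) — REDUCED TO THE LEVEL PIN: `isCMNewformOf_of_modularForms` (CGS predicate ⇒ YanZhu2026 predicate, same
  level), `hasInfinityType_div_normCharacter_pow` (`ξ / N^{m+1}` has type `(0, m+n+2)`), `exists_isCMNewformOf_someLevel`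
  (Ribet's fact ⇒ a CM newform of weight `m+n+3` at SOME level); the pin to level `|d_K|` is the hypothesis `hpin` of
  `frameAux_of_facts`, which delivers (S2) VERBATIM at `D := (NumberField.discr K).natAbs`.
NO `sorry`, NO `def … : Prop`, hypotheses only; imports Literature/Mathlib only (no Summits import). Consumer recipe: in
`rich_of_two_characters … (haux := frameAuxGrid_of_facts hJ hpin hK hf.1 hH A B hunrA hunrB a₁ a₂ b₁ b₂ hb₁ hb₂ htA htB)` (at `D := (NumberField.discr K).natAbs`, the crux's frame level) with the
crux's binders `hK : IsImaginaryQuadratic K`, `hf : IsNewformOf W f` (`.1 : IsNewform0 f`), `hH` = the crux's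
«every `ℓ ∣ N` splits» binder (= `SatisfiesHeegnerHypothesis N K` by `Iff.rfl`), `[NeZero (NumberField.discr K).natAbs]`.
NOT CLAIMED: the level pin; the two named facts; anything of (I)/(II) of annex §9. no summit statement is proved here; BSD is
not proved.

References: [Jacquet1972] §19 Thm. 19.14, Cor. 19.15; [Li1979] Thm. 2.2; [Ribet1977Nebentypus] §3 Thm. (3.4), Cor. (3.5),
Remark (3.5); [Miyake2006] Thm. 4.8.2 (p. 183); Köhler, *Eta Products and Theta Series Identities* (Springer Monographs, 2011)
Thm. 5.1 [galaxy:panama:309211875508234 p. 72]; [YanZhu2024MainConjNonCM] Thm. 3.9 (`θ_{ξ_b}`); [CastellaHsieh2018] §3.3.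
-/

noncomputable section
set_option linter.dupNamespace false

open scoped MatrixGroups ModularForm Topology
open CongruenceSubgroup NumberField IsDedekindDomain Field
open Literature.NumberTheory.GaloisRepresentations
open Literature.NumberTheory.EllipticCurves.ModularForms
open Literature.NumberTheory.EllipticCurves
open Literature.NumberTheory.Automorphic

namespace Summit.BirchSwinnertonDyer.BirchSwinnertonDyer.Cruxes.TwoVariableEulerSystemDivisibility.SplitsliceSeams

variable {F₀ K : Type} [Field F₀] [Field K] [NumberField K] [Algebra F₀ K] {N : ℕ}

/-- `φ ∘ σ` extended by zero at `v` is `φ` extended by zero at `σ • v`. -/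
theorem heckeValueExtZero_galConj (σ : K ≃ₐ[F₀] K) (φ : HeckeCharacter K) (v : HeightOneSpectrum (𝓞 K)) :
    heckeValueExtZero (HeckeCharacter.galConj σ φ) v = heckeValueExtZero φ (σ • v) := by
  by_cases h : φ.IsUnramifiedAt (σ • v)
  · rw [heckeValueExtZero_of_isUnramifiedAt ((HeckeCharacter.isUnramifiedAt_galConj_iff σ φ v).2 h),
      heckeValueExtZero_of_isUnramifiedAt h, HeckeCharacter.valueAtUniformizer_galConj_of_isUnramifiedAt σ φ v h]
  · rw [heckeValueExtZero_of_not_isUnramifiedAt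
        (fun h' => h ((HeckeCharacter.isUnramifiedAt_galConj_iff σ φ v).1 h')),
      heckeValueExtZero_of_not_isUnramifiedAt h]

/-- The inverse local factor of `L(f/K, φ ∘ σ, s)` at `v` is that of `L(f/K, φ, s)` at `σ • v`. -/
theorem rankinSelbergLocalFactorInvHecke_galConj (f : CuspForm (Gamma0 N) 2) (σ : K ≃ₐ[F₀] K)
    (φ : HeckeCharacter K) (v : HeightOneSpectrum (𝓞 K)) (s : ℂ) :
    rankinSelbergLocalFactorInvHecke f (HeckeCharacter.galConj σ φ) v s =
      rankinSelbergLocalFactorInvHecke f φ (σ • v) s := by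
  simp only [rankinSelbergLocalFactorInvHecke, heckeValueExtZero_galConj,
    HeightOneSpectrum.absNorm_algEquiv_smul]

/-- **Conjugation invariance of the Euler product**: `L(f/K, φ ∘ σ, s) = L(f/K, φ, s)` for every
`σ ∈ Aut(K/F₀)` and every `s` (a reindexing of the `tprod` by `v ↦ σ • v`; no convergence needed). -/
theorem rankinSelbergEulerProductHecke_galConj (f : CuspForm (Gamma0 N) 2) (σ : K ≃ₐ[F₀] K)
    (φ : HeckeCharacter K) (s : ℂ) :
    rankinSelbergEulerProductHecke f (HeckeCharacter.galConj σ φ) s = rankinSelbergEulerProductHecke f φ s := by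
  unfold rankinSelbergEulerProductHecke
  simp_rw [rankinSelbergLocalFactorInvHecke_galConj]
  exact Equiv.tprod_eq (MulAction.toPerm σ) (fun v => (rankinSelbergLocalFactorInvHecke f φ v s)⁻¹)

/-- **The conjugate-cone continuation** from Jacquet's fact: for `K` imaginary quadratic, `f` a
`Γ₀(N)` newform with the Heegner hypothesis, and `ξ` everywhere unramified of infinity type
`(−(m+1), n+1)`, the Euler product `L(f/K, ξ, s)` has an entire continuation from `re s > m + n + 3`
(apply the fact to `ξ ∘ c`, of type `(n+1, −(m+1))`, and use conjugation invariance). -/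
theorem exists_entire_of_conjugateCone (h : jacquet1972_functionalEquation_rankinSelbergHecke_cone)
    (hK : IsImaginaryQuadratic K) [NeZero N] {f : CuspForm (Gamma0 N) 2} (hf : IsNewform0 f)
    (hH : SatisfiesHeegnerHypothesis N K) (ξ : HeckeCharacter K) (m n : ℕ)
    (hunr : ∀ v : HeightOneSpectrum (𝓞 K), ξ.IsUnramifiedAt v)
    (hinf : ξ.HasInfinityType (fun _ ↦ -((m : ℤ) + 1)) (fun _ ↦ (n : ℤ) + 1)) :
    ∃ L : ℂ → ℂ, Differentiable ℂ L ∧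
      ∀ s : ℂ, (m : ℝ) + n + 3 < s.re → L s = rankinSelbergEulerProductHecke f ξ s := by
  haveI : IsCMField K := hK.isCMField
  set c := IsCMField.complexConj K
  have hunr' : ∀ v : HeightOneSpectrum (𝓞 K), (HeckeCharacter.galConj c ξ).IsUnramifiedAt v := fun v =>
    (HeckeCharacter.isUnramifiedAt_galConj_iff c ξ v).2 (hunr _)
  have hinf' : (HeckeCharacter.galConj c ξ).HasInfinityType (fun _ ↦ ((n + 1 : ℕ) : ℤ))
      (fun _ ↦ -((m + 1 : ℕ) : ℤ)) := by
    convert hinf.galConj_complexConj using 2 <;> push_cast <;> ring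
  obtain ⟨L, hL, hLe⟩ := jacquet1972_functionalEquation_rankinSelbergHecke_cone.exists_entire h hK hf hH
    (HeckeCharacter.galConj c ξ) (Nat.succ_pos n) (Nat.succ_pos m) hunr' hinf'
  refine ⟨L, hL, fun s hs => ?_⟩
  rw [← rankinSelbergEulerProductHecke_galConj f c ξ s]
  exact hLe s (by push_cast; linarith)

/-! ### SEAM 1 (partial): the predicate bridge CGS → YanZhu2026 and CM-newform existence at SOME level -/

/-- The CGS predicate `ModularForms.IsCMNewformOf ψ M k g` (Ribet's conclusion verbatim, with the two
ramification conjuncts) implies YanZhu2026's `IsCMNewformOf ψ g` (Hecke polynomials off the level only)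
at the SAME level and weight. -/
theorem isCMNewformOf_of_modularForms {ψ : HeckeCharacter K} {M : ℕ} [NeZero M] {k : ℕ}
    {g : CuspForm (Gamma1 M) (k : ℤ)} (h : ModularForms.IsCMNewformOf ψ M k g) : IsCMNewformOf ψ g :=
  ⟨h.1, fun v hv => (h.2 v hv).2.2⟩

/-- An imaginary quadratic field is not totally real. -/
theorem not_isTotallyReal_of_isImaginaryQuadratic (hK : IsImaginaryQuadratic K) : ¬ IsTotallyReal K := fun h => by
  haveI : IsTotallyComplex K := hK.2
  obtain ⟨w⟩ : Nonempty (InfinitePlace K) := inferInstance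
  exact InfinitePlace.not_isReal_iff_isComplex.2 (IsTotallyComplex.isComplex w) (h.isReal w)

/-- For `K` imaginary quadratic and `ξ` of infinity type `(−(m+1), n+1)`, the character `ξ / N^{m+1}`
(`N` = the norm character, type `(−1, −1)`) has infinity type `(0, m+n+2) = (0, k−1)`, `k = m+n+3`. -/
theorem hasInfinityType_div_normCharacter_pow (hK : IsImaginaryQuadratic K) {ξ : HeckeCharacter K} {m n : ℕ}
    (hinf : ξ.HasInfinityType (fun _ ↦ -((m : ℤ) + 1)) (fun _ ↦ (n : ℤ) + 1)) :
    (ξ / HeckeCharacter.normCharacter K ^ (m + 1)).HasInfinityType (fun _ => 0)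
      (fun _ => (((m + n + 3 : ℕ) : ℤ)) - 1) := by
  classical
  haveI : IsTotallyComplex K := hK.2
  have hN := (HeckeCharacter.hasInfinityType_normCharacter' (K := K)).zpow' (-((m : ℤ) + 1))
  have hreal : ∀ w : InfinitePlace K, ¬ w.IsReal := fun w =>
    InfinitePlace.not_isReal_iff_isComplex.2 (IsTotallyComplex.isComplex w)
  rw [div_eq_mul_inv, ← zpow_natCast, ← zpow_neg]
  have e1 : (fun _ : InfinitePlace K => (0 : ℤ)) =
      (fun _ : InfinitePlace K => -((m : ℤ) + 1)) + -((m : ℤ) + 1) • (fun _ : InfinitePlace K => (-1 : ℤ)) := by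
    funext w; simp only [Pi.add_apply, Pi.smul_apply, smul_eq_mul]; ring
  have e2 : (fun _ : InfinitePlace K => (((m + n + 3 : ℕ) : ℤ)) - 1) =
      (fun _ : InfinitePlace K => (n : ℤ) + 1) +
        -((m : ℤ) + 1) • (fun w : InfinitePlace K => if w.IsReal then (0 : ℤ) else -1) := by
    funext w; simp only [Pi.add_apply, Pi.smul_apply, smul_eq_mul, if_neg (hreal w)]; push_cast; ring
  rw [e1, e2]
  exact hinf.mul' hN

/-- **CM newform of `ξ / N^{m+1}` at SOME level**, granted Ribet's fact: for `K` imaginary quadratic and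
`ξ` of type `(−(m+1), n+1)` there are a level `M` and a newform `θ ∈ S_{m+n+3}(Γ₁(M))` with
`IsCMNewformOf (ξ / N^{m+1}) θ` (YanZhu2026's predicate). What is NOT delivered: the level pin
`M = |d_K|` for everywhere-unramified `ξ` (Ribet 1977 Thm. (3.4): level `D · N𝔪`; the tree's fact leaves
the level existential — its TODO). -/
theorem exists_isCMNewformOf_someLevel (h : Ribet1977_cmNewform_of_heckeCharacter) (hK : IsImaginaryQuadratic K)
    (ξ : HeckeCharacter K) (m n : ℕ)
    (hinf : ξ.HasInfinityType (fun _ ↦ -((m : ℤ) + 1)) (fun _ ↦ (n : ℤ) + 1)) :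
    ∃ (M : ℕ) (_ : NeZero M) (θ : CuspForm (Gamma1 M) ((m + n + 3 : ℕ) : ℤ)),
      IsCMNewformOf (ξ / HeckeCharacter.normCharacter K ^ (m + 1)) θ := by
  obtain ⟨M, hM, g, hg⟩ := exists_isCMNewformOf h hK.1 (not_isTotallyReal_of_isImaginaryQuadratic hK)
    (k := m + n + 3) (by omega) (Or.inr (hasInfinityType_div_normCharacter_pow hK hinf))
  exact ⟨M, hM, g, isCMNewformOf_of_modularForms hg⟩

/-! ### The junction: (S2) of the frame from the two named facts and the level pin -/

/-- `ξ / N^{m+1}` is everywhere unramified if `ξ` is. -/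
theorem isUnramifiedAt_div_normCharacter_pow {ξ : HeckeCharacter K} (hunr : ∀ v : HeightOneSpectrum (𝓞 K), ξ.IsUnramifiedAt v)
    (k : ℕ) (v : HeightOneSpectrum (𝓞 K)) : (ξ / HeckeCharacter.normCharacter K ^ k).IsUnramifiedAt v := by
  rw [div_eq_mul_inv, ← zpow_natCast]
  exact (hunr v).mul' ((HeckeCharacter.isUnramifiedAt_normCharacter' v).zpow' _).inv'

/-- **(S2) OF THE FRAME FROM THE FACTS AND THE LEVEL PIN.** Granted Jacquet's cone fact `hJ`, the LEVEL PIN `hpin`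
(every everywhere-unramified Hecke character of `K` of type `(k−1, 0)` or `(0, k−1)`, `k ≥ 2`, has a CM newform of
weight `k` ON `Γ₁(|d_K|)` in YanZhu2026's sense — Ribet 1977 Thm. (3.4)/Remark (3.5) at conductor `1`; NOT in the tree),
`K` imaginary quadratic, `f ∈ S₂(Γ₀(N))` a newform with the Heegner hypothesis: every everywhere-unramified `ξ` of type
`(−(m+1), n+1)` carries the frame's auxiliary datum at level `D = |d_K|` and weight `m + n + 3`. -/
theorem frameAux_of_facts (hJ : jacquet1972_functionalEquation_rankinSelbergHecke_cone)
    [NeZero (NumberField.discr K).natAbs]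
    (hpin : ∀ (ψ : HeckeCharacter K) (k : ℕ), 2 ≤ k → (∀ v : HeightOneSpectrum (𝓞 K), ψ.IsUnramifiedAt v) →
      (ψ.HasInfinityType (fun _ => (k : ℤ) - 1) (fun _ => 0) ∨ ψ.HasInfinityType (fun _ => 0) (fun _ => (k : ℤ) - 1)) →
      ∃ θ : CuspForm (Gamma1 (NumberField.discr K).natAbs) (k : ℤ), IsCMNewformOf ψ θ)
    (hK : IsImaginaryQuadratic K) [NeZero N] {f : CuspForm (Gamma0 N) 2} (hf : IsNewform0 f)
    (hH : SatisfiesHeegnerHypothesis N K) (ξ : HeckeCharacter K) (m n : ℕ)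
    (hunr : ∀ v : HeightOneSpectrum (𝓞 K), ξ.IsUnramifiedAt v)
    (hinf : ξ.HasInfinityType (fun _ ↦ -((m : ℤ) + 1)) (fun _ ↦ (n : ℤ) + 1)) :
    ∃ (θ : CuspForm (Gamma1 (NumberField.discr K).natAbs) ((m + n + 3 : ℕ) : ℤ)) (L : ℂ → ℂ),
      IsCMNewformOf (ξ / HeckeCharacter.normCharacter K ^ (m + 1)) θ ∧ Differentiable ℂ L ∧
        ∀ s : ℂ, (m : ℝ) + n + 3 < s.re → L s = rankinSelbergEulerProductHecke f ξ s := by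
  obtain ⟨θ, hθ⟩ := hpin (ξ / HeckeCharacter.normCharacter K ^ (m + 1)) (m + n + 3) (by omega)
    (isUnramifiedAt_div_normCharacter_pow hunr (m + 1)) (Or.inr (hasInfinityType_div_normCharacter_pow hK hinf))
  obtain ⟨L, hL, hLe⟩ := exists_entire_of_conjugateCone hJ hK hf hH ξ m n hunr hinf
  exact ⟨θ, L, hθ, hL, hLe⟩

/-! ### The grid form: exactly the `haux` binder of `SplitsliceFam.rich_of_two_characters` -/

/-- Powers of an everywhere-unramified character are everywhere unramified (copy of `SplitsliceFam`'s §F13 lemma,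
kept local so that this file imports Literature only). -/
theorem isUnramifiedAt_pow_succ {A : HeckeCharacter K} (hunr : ∀ w : HeightOneSpectrum (𝓞 K), A.IsUnramifiedAt w)
    (k : ℕ) (w : HeightOneSpectrum (𝓞 K)) : (A ^ (k + 1)).IsUnramifiedAt w := by
  induction k with
  | zero => simpa using hunr w
  | succ k ih => rw [pow_succ']; exact (hunr w).mul' ih

/-- Infinity type of a power (copy of `SplitsliceFam`'s §F13 lemma). -/
theorem hasInfinityType_pow_succ {A : HeckeCharacter K} {a b : ℤ}
    (h : A.HasInfinityType (fun _ ↦ a) (fun _ ↦ b)) (k : ℕ) :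
    (A ^ (k + 1)).HasInfinityType (fun _ ↦ ((k : ℤ) + 1) * a) (fun _ ↦ ((k : ℤ) + 1) * b) := by
  induction k with
  | zero => simpa using h
  | succ k ih =>
    rw [pow_succ']
    convert h.mul' ih using 2 <;> (simp only [Pi.add_apply]; push_cast; ring)

/-- **THE GRID (S2) FROM THE FACTS AND THE LEVEL PIN** — VERBATIM the binder `haux` of
`SplitsliceFam.rich_of_two_characters` at `D := (NumberField.discr K).natAbs`: for everywhere-unramified `A` (type
`(−a₁, a₂)`) and `B` (type `(−b₁, b₂)`, `b₁, b₂ ≥ 1`), every grid character `ξ_{ij} = B^{j+1} A^{i+1}` carries the frame's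
auxiliary datum. So, granted the two named facts and the level pin, §F13's inputs are (I) `A, B, rA, rB` and (II) the three
value conditions ONLY. -/
theorem frameAuxGrid_of_facts (hJ : jacquet1972_functionalEquation_rankinSelbergHecke_cone)
    [NeZero (NumberField.discr K).natAbs]
    (hpin : ∀ (ψ : HeckeCharacter K) (k : ℕ), 2 ≤ k → (∀ v : HeightOneSpectrum (𝓞 K), ψ.IsUnramifiedAt v) →
      (ψ.HasInfinityType (fun _ => (k : ℤ) - 1) (fun _ => 0) ∨ ψ.HasInfinityType (fun _ => 0) (fun _ => (k : ℤ) - 1)) →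
      ∃ θ : CuspForm (Gamma1 (NumberField.discr K).natAbs) (k : ℤ), IsCMNewformOf ψ θ)
    (hK : IsImaginaryQuadratic K) [NeZero N] {f : CuspForm (Gamma0 N) 2} (hf : IsNewform0 f)
    (hH : SatisfiesHeegnerHypothesis N K) (A B : HeckeCharacter K)
    (hunrA : ∀ w : HeightOneSpectrum (𝓞 K), A.IsUnramifiedAt w)
    (hunrB : ∀ w : HeightOneSpectrum (𝓞 K), B.IsUnramifiedAt w)
    (a₁ a₂ b₁ b₂ : ℕ) (hb₁ : 1 ≤ b₁) (hb₂ : 1 ≤ b₂)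
    (htA : A.HasInfinityType (fun _ ↦ -(a₁ : ℤ)) (fun _ ↦ (a₂ : ℤ)))
    (htB : B.HasInfinityType (fun _ ↦ -(b₁ : ℤ)) (fun _ ↦ (b₂ : ℤ))) :
    ∀ i j : ℕ, ∃ (θ : CuspForm (Gamma1 (NumberField.discr K).natAbs)
        ((((i + 1) * a₁ + (j + 1) * b₁ - 1) + ((i + 1) * a₂ + (j + 1) * b₂ - 1) + 3 : ℕ) : ℤ)) (L : ℂ → ℂ),
      IsCMNewformOf (B ^ (j + 1) * A ^ (i + 1) / HeckeCharacter.normCharacter K ^ (((i + 1) * a₁ + (j + 1) * b₁ - 1) + 1)) θ ∧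
      Differentiable ℂ L ∧
      ∀ s : ℂ, ((((i + 1) * a₁ + (j + 1) * b₁ - 1 : ℕ)) : ℝ) + (((i + 1) * a₂ + (j + 1) * b₂ - 1 : ℕ)) + 3 < s.re →
        L s = rankinSelbergEulerProductHecke f (B ^ (j + 1) * A ^ (i + 1)) s := by
  intro i j
  have hm : ((((i + 1) * a₁ + (j + 1) * b₁ - 1 : ℕ)) : ℤ) + 1 = (((i + 1) * a₁ + (j + 1) * b₁ : ℕ) : ℤ) := by
    exact_mod_cast Nat.sub_add_cancel (le_add_left (Nat.mul_pos (Nat.succ_pos j) hb₁))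
  have hn : ((((i + 1) * a₂ + (j + 1) * b₂ - 1 : ℕ)) : ℤ) + 1 = (((i + 1) * a₂ + (j + 1) * b₂ : ℕ) : ℤ) := by
    exact_mod_cast Nat.sub_add_cancel (le_add_left (Nat.mul_pos (Nat.succ_pos j) hb₂))
  refine frameAux_of_facts hJ hpin hK hf hH _ _ _
    (fun w => (isUnramifiedAt_pow_succ hunrB j w).mul' (isUnramifiedAt_pow_succ hunrA i w)) ?_
  have h := (hasInfinityType_pow_succ htB j).mul' (hasInfinityType_pow_succ htA i)
  convert h using 2
  · simp only [Pi.add_apply]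
    rw [hm]
    push_cast
    ring
  · simp only [Pi.add_apply]
    rw [hn]
    push_cast
    ring

/-! ### (II), first value condition — an ANTICYCLOTOMIC avatar is `1` on the cyclotomic generator

The hypothesis `hB₁ : avatarValueAt rB g₁ = 1` (`g₁ = γ₁⁻¹`) of `SplitsliceFam.rich_of_two_characters` from
STRUCTURE: `κ₁` cyclotomic, `κ₂` anticyclotomic, `(γ₁, γ₂)` an adapted generator pair, `rB` through the pair and
ANTICYCLOTOMIC AS A GALOIS CHARACTER at a lift `ρ ∈ Γ_ℚ ∖ res Γ_K` of complex conjugation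
(`rB(τ) = rB(σ)⁻¹` whenever `res τ = ρ (res σ) ρ⁻¹` — the avatar-side shadow of `B ∘ c = B⁻¹`, which holds for the
classical witness `B = (Ψ^c/Ψ)^M`). Proof: `τ := res⁻¹(ρ res(γ₁⁻¹) ρ⁻¹)` has the same pair coordinates as `γ₁⁻¹`
(`κ₁` is fixed by outer conjugation — tree `IsCyclotomic.apply_eq_of_absGaloisRestrict_eq_conj`; `κ₂` is inverted and
`κ₂(γ₁) = 0`), so `rB(γ₁⁻¹) = rB(τ) = rB(γ₁⁻¹)⁻¹`; a principal unit (tree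
`norm_avatarValueAt_sub_one_lt_of_factorsThroughPair`) equal to its inverse is `1` when `p ≠ 2`. -/

section ValueConditionOne

variable {p : ℕ} [Fact p.Prime]

/-- `‖2‖ < 1` fails in `ℂ_p` for `p ≠ 2`. [folklore] -/
theorem not_norm_two_lt_one (hp2 : p ≠ 2) : ¬ ‖(2 : ℂ_[p])‖ < 1 := by
  intro h
  have e : ‖(2 : ℂ_[p])‖ = ‖((2 : ℕ) : ℚ_[p])‖ := by
    rw [← map_ofNat (algebraMap ℚ_[p] ℂ_[p]) 2]
    exact (PadicComplex.norm_extends' (p := p) (2 : ℚ_[p])).trans (by simp)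
  rw [e, Padic.norm_natCast_lt_one_iff] at h
  have h2 : p ∣ 2 := h
  exact hp2 ((Nat.prime_dvd_prime_iff_eq Fact.out Nat.prime_two).mp h2)

/-- A principal unit of `ℂ_p` equal to its own inverse is `1` (`p ≠ 2`). [folklore] -/
theorem eq_one_of_norm_sub_one_lt_of_eq_inv (hp2 : p ≠ 2) {u : ℂ_[p]} (hu : ‖u - 1‖ < 1)
    (hinv : u = u⁻¹) : u = 1 := by
  have hu0 : u ≠ 0 := by
    rintro rfl
    simp at hu
  have h1 : u * u = 1 := by
    have : u * u⁻¹ = 1 := mul_inv_cancel₀ hu0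
    rwa [← hinv] at this
  by_contra hne
  have hfac : (u - 1) * (u + 1) = 0 := by
    have : (u - 1) * (u + 1) = u * u - 1 := by ring
    rw [this, h1, sub_self]
  have hu1 : u + 1 = 0 := (mul_eq_zero.mp hfac).resolve_left (sub_ne_zero.mpr hne)
  have h2 : (2 : ℂ_[p]) = -(u - 1) := by linear_combination hu1
  exact not_norm_two_lt_one hp2 (by rw [h2, norm_neg]; exact hu)

/-- **(II)-1: `rB(γ₁⁻¹) = 1` for an anticyclotomic avatar through a (cyclotomic, anticyclotomic) pair.** -/
theorem avatarValueAt_inv_eq_one_of_anticyclotomic [IsGalois ℚ K] {κ₁ κ₂ : ZpExtension K p}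
    {γ₁ γ₂ : absoluteGaloisGroup K} {r : FramedGaloisRep K (PadicAlgCl p) 1} (hp2 : p ≠ 2)
    (hr : FactorsThroughPair κ₁ κ₂ r) (hκ₁ : κ₁.IsCyclotomic) (hκ₂ : κ₂.IsAnticyclotomic)
    (hγ : ZpExtension.IsTopGeneratorPair κ₁ κ₂ γ₁ γ₂)
    (ρ : absoluteGaloisGroup ℚ) (hρ : ρ ∉ Set.range (absGaloisRestrict ℚ K))
    (hanti : ∀ σ τ : absoluteGaloisGroup K,
      absGaloisRestrict ℚ K τ = ρ * absGaloisRestrict ℚ K σ * ρ⁻¹ → avatarValueAt r τ = (avatarValueAt r σ)⁻¹) :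
    avatarValueAt r γ₁⁻¹ = 1 := by
  obtain ⟨τ, hτ⟩ := conj_absGaloisRestrict_mem_range ℚ K ρ γ₁⁻¹
  have h1 : κ₁ τ = κ₁ γ₁⁻¹ := hκ₁.apply_eq_of_absGaloisRestrict_eq_conj hτ
  have h2 : κ₂ τ = κ₂ γ₁⁻¹ := by
    rw [hκ₂ _ _ ρ hρ hτ, map_inv, hγ.apply_left, inv_one, inv_one]
  have hc : ZpExtension.pairCoord κ₁ κ₂ τ = ZpExtension.pairCoord κ₁ κ₂ γ₁⁻¹ := by
    rw [ZpExtension.pairCoord_apply, ZpExtension.pairCoord_apply, h1, h2]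
  have hpair : avatarValueAt r τ = avatarValueAt r γ₁⁻¹ := ZpExtension.avatarValueAt_eq_of_pairCoord_eq hr hc
  have hinv := hanti _ _ hτ
  rw [hpair] at hinv
  exact eq_one_of_norm_sub_one_lt_of_eq_inv hp2 (norm_avatarValueAt_sub_one_lt_of_factorsThroughPair hr _) hinv

/-- The same at `γ₁` itself (`rB(γ₁) = rB(γ₁⁻¹)⁻¹ = 1`). -/
theorem avatarValueAt_eq_one_of_anticyclotomic [IsGalois ℚ K] {κ₁ κ₂ : ZpExtension K p}
    {γ₁ γ₂ : absoluteGaloisGroup K} {r : FramedGaloisRep K (PadicAlgCl p) 1} (hp2 : p ≠ 2)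
    (hr : FactorsThroughPair κ₁ κ₂ r) (hκ₁ : κ₁.IsCyclotomic) (hκ₂ : κ₂.IsAnticyclotomic)
    (hγ : ZpExtension.IsTopGeneratorPair κ₁ κ₂ γ₁ γ₂)
    (ρ : absoluteGaloisGroup ℚ) (hρ : ρ ∉ Set.range (absGaloisRestrict ℚ K))
    (hanti : ∀ σ τ : absoluteGaloisGroup K,
      absGaloisRestrict ℚ K τ = ρ * absGaloisRestrict ℚ K σ * ρ⁻¹ → avatarValueAt r τ = (avatarValueAt r σ)⁻¹) :
    avatarValueAt r γ₁ = 1 := by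
  have h := avatarValueAt_inv_eq_one_of_anticyclotomic hp2 hr hκ₁ hκ₂ hγ ρ hρ hanti
  have hmul : avatarValueAt r γ₁ * avatarValueAt r γ₁⁻¹ = 1 := by
    rw [← avatarValueAt_mul, mul_inv_cancel, avatarValueAt_one]
  rwa [h, mul_one] at hmul

end ValueConditionOne

/-! ### (II)-1 continued — the ANTICYCLOTOMIC-AVATAR hypothesis from `B ∘ c · B = 1` (avatar rigidity)

`hanti` of `avatarValueAt_inv_eq_one_of_anticyclotomic` DISCHARGED for any everywhere-unramified `B` with
`(B ∘ σ̄) · B = 1`, `σ̄ = ρ̄ ∈ Gal(K/ℚ)` (the classical witness `B = (Ψ^c/Ψ)^M` has this): the outer conjugate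
`rB^ρ` is an avatar of `B ∘ ρ̄` (Frobenius transport, tree `hasFrobCharpolyAt_outerConj_iff`), so `rB ⊗ det rB^ρ` is an
avatar of `(B ∘ ρ̄) · B = 1` (tree `IsPAdicAvatarOf.mul_twist`), hence EQUAL to the trivial representation by the tree's
avatar rigidity (`IsPAdicAvatarOutside.eq_of_isPAdicAvatarOf`, Chebotarev — `ChebotarevArtinRepHolds`): `rB(θ_ρ σ)·rB(σ) = 1`. -/

section AnticyclotomicWitness

variable {p : ℕ} [Fact p.Prime]

/-- `p ∈ 𝔭_{σ̄ • v} ↔ p ∈ 𝔭_v` (`σ̄` fixes `p`). [folklore] -/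
theorem natCast_mem_algEquiv_smul_asIdeal_iff (σ : K ≃ₐ[ℚ] K) (v : HeightOneSpectrum (𝓞 K)) (n : ℕ) :
    ((n : ℕ) : 𝓞 K) ∈ (σ • v).asIdeal ↔ ((n : ℕ) : 𝓞 K) ∈ v.asIdeal := by
  have h : σ • ((n : ℕ) : 𝓞 K) = ((n : ℕ) : 𝓞 K) := map_natCast (MulSemiringAction.toRingHom _ (𝓞 K) σ) n
  rw [← HeightOneSpectrum.smul_mem_smul_asIdeal_iff σ v, h]

/-- **Avatars are functorial under outer conjugation**: if `r` is the `p`-adic avatar of `φ` then `r^τ = r ∘ θ_τ` is the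
avatar of `φ ∘ τ̄` (`τ̄ ∈ Gal(K/ℚ)` the image of `τ ∈ Γ_ℚ`). [folklore; Serre 1968 Ch. I §2.3] -/
theorem isPAdicAvatarOf_galConj_outerConj [IsGalois ℚ K] {ι : PadicAlgCl p ≃+* ℂ} {φ : HeckeCharacter K}
    {r : FramedGaloisRep K (PadicAlgCl p) 1} (hr : IsPAdicAvatarOf ι φ r) (τ : absoluteGaloisGroup ℚ) :
    IsPAdicAvatarOf ι (HeckeCharacter.galConj (absGaloisQuot ℚ K τ) φ) (r.outerConj τ) := by
  intro v hv hunr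
  have hunr' : φ.IsUnramifiedAt (absGaloisQuot ℚ K τ • v) :=
    (HeckeCharacter.isUnramifiedAt_galConj_iff _ φ v).mp hunr
  have hv' : ((p : ℕ) : 𝓞 K) ∉ (absGaloisQuot ℚ K τ • v).asIdeal := fun h =>
    hv ((natCast_mem_algEquiv_smul_asIdeal_iff _ v p).mp h)
  obtain ⟨h1, h2⟩ := hr _ hv' hunr'
  refine ⟨(FramedGaloisRep.isUnramifiedAt_outerConj_iff τ r v).mpr h1, ?_⟩
  rw [FramedGaloisRep.hasFrobCharpolyAt_outerConj_iff,
    HeckeCharacter.valueAtUniformizer_galConj_of_isUnramifiedAt _ φ v hunr']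
  exact h2

/-- `r^ρ(σ) = r(θ_ρ σ)`. -/
theorem avatarValueAt_outerConj [IsGalois ℚ K] (r : FramedGaloisRep K (PadicAlgCl p) 1) (ρ : absoluteGaloisGroup ℚ)
    (σ : absoluteGaloisGroup K) : avatarValueAt (r.outerConj ρ) σ = avatarValueAt r (absGaloisOuterConj ℚ K ρ σ) := rfl

/-- **`(B ∘ ρ̄) · B = 1` ⇒ the avatar of `B` is anticyclotomic at `ρ` as a Galois character**: `rB(τ) = rB(σ)⁻¹`
whenever `res τ = ρ (res σ) ρ⁻¹`. Avatar rigidity (Chebotarev, in the tree) applied to `rB ⊗ det rB^ρ` vs `1`. -/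
theorem avatarValueAt_eq_inv_of_galConj_mul_self_eq_one [IsGalois ℚ K] {ι : PadicAlgCl p ≃+* ℂ} {B : HeckeCharacter K}
    {rB : FramedGaloisRep K (PadicAlgCl p) 1} (hrB : IsPAdicAvatarOf ι B rB)
    (hunrB : ∀ w : HeightOneSpectrum (𝓞 K), B.IsUnramifiedAt w) (ρ : absoluteGaloisGroup ℚ)
    (hB : HeckeCharacter.galConj (absGaloisQuot ℚ K ρ) B * B = 1) :
    ∀ σ τ : absoluteGaloisGroup K, absGaloisRestrict ℚ K τ = ρ * absGaloisRestrict ℚ K σ * ρ⁻¹ →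
      avatarValueAt rB τ = (avatarValueAt rB σ)⁻¹ := by
  intro σ τ hτ
  have hτ' : τ = absGaloisOuterConj ℚ K ρ σ :=
    absGaloisRestrict_injective ℚ K (by rw [hτ, absGaloisRestrict_absGaloisOuterConj])
  have htw : IsPAdicAvatarOf ι (HeckeCharacter.galConj (absGaloisQuot ℚ K ρ) B * B)
      (FramedRep.twist rB (detChar (rB.outerConj ρ))) :=
    IsPAdicAvatarOf.mul_twist hrB (isPAdicAvatarOf_galConj_outerConj hrB ρ)
      (fun v _ => (HeckeCharacter.isUnramifiedAt_galConj_iff _ B v).mpr (hunrB _))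
  rw [hB] at htw
  have heq : FramedRep.twist rB (detChar (rB.outerConj ρ)) = 1 :=
    (htw.isPAdicAvatarOutside ∅).eq_of_isPAdicAvatarOf (isPAdicAvatarOf_one ι)
  have hval : avatarValueAt (FramedRep.twist rB (detChar (rB.outerConj ρ))) σ = 1 := by
    rw [heq, avatarValueAt_one_left]
  rw [avatarValueAt_twist_detChar, avatarValueAt_outerConj, ← hτ'] at hval
  exact eq_inv_of_mul_eq_one_left hval

/-- **(II)-1 UNCONDITIONALLY IN THE AVATAR**: for `κ₁` cyclotomic, `κ₂` anticyclotomic, `(γ₁, γ₂)` adapted, `B`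
everywhere unramified with `(B ∘ ρ̄) · B = 1` for some `ρ ∈ Γ_ℚ ∖ res Γ_K`, and `rB` ITS avatar through the pair:
`rB(γ₁⁻¹) = 1` (`p ≠ 2`). The remaining input of (II)-1 for the classical witness is only `(B ∘ c)·B = 1`, an identity
of Hecke characters (`B = (Ψ^c/Ψ)^M`: `galConj_mul`, `galConj_inv`, `galConj_galConj`, `c² = 1`). -/
theorem avatarValueAt_inv_eq_one_of_galConj_mul_self_eq_one [IsGalois ℚ K] {ι : PadicAlgCl p ≃+* ℂ}
    {κ₁ κ₂ : ZpExtension K p} {γ₁ γ₂ : absoluteGaloisGroup K} {B : HeckeCharacter K}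
    {rB : FramedGaloisRep K (PadicAlgCl p) 1} (hp2 : p ≠ 2) (hrB : IsPAdicAvatarOf ι B rB)
    (hκB : FactorsThroughPair κ₁ κ₂ rB) (hunrB : ∀ w : HeightOneSpectrum (𝓞 K), B.IsUnramifiedAt w)
    (hκ₁ : κ₁.IsCyclotomic) (hκ₂ : κ₂.IsAnticyclotomic) (hγ : ZpExtension.IsTopGeneratorPair κ₁ κ₂ γ₁ γ₂)
    (ρ : absoluteGaloisGroup ℚ) (hρ : ρ ∉ Set.range (absGaloisRestrict ℚ K))
    (hB : HeckeCharacter.galConj (absGaloisQuot ℚ K ρ) B * B = 1) :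
    avatarValueAt rB γ₁⁻¹ = 1 :=
  avatarValueAt_inv_eq_one_of_anticyclotomic hp2 hκB hκ₁ hκ₂ hγ ρ hρ
    (avatarValueAt_eq_inv_of_galConj_mul_self_eq_one hrB hunrB ρ hB)

end AnticyclotomicWitness

/-! ### (II)-2 and (II)-3 — the two INFINITE-ORDER value conditions in kernel (pair determination + Hecke rigidity)

`hA₁ : Function.Injective (k ↦ rA(γ₁⁻¹)^k)` and `hB₂ : Function.Injective (k ↦ rB(γ₂⁻¹)^k)` of `rich_of_two_characters`
PROVED for every everywhere-unramified `A` of type `(a₁, a₂)` with `a₁ + a₂ ≠ 0` resp. `B` of type `(b₁, b₂) ≠ (0, 0)` with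
`rB(γ₁⁻¹) = 1`, avatars through the adapted pair (`κ₁` cyclotomic, `κ₂` anticyclotomic), `K` imaginary quadratic. Mechanism
(no Hodge–Tate theory): a rank-one avatar through the pair is DETERMINED by its values at `γ₁, γ₂` (continuity of the
descended character on `ℤ_p²`, density of `ℕ²` — tree `isContinuousChar₂_pairChar`); if a value were torsion, a power /
conjugate-product character would have TRIVIAL avatar, hence trivial Frobenius values off `p` (tree
`IsPAdicAvatarOutside.avatarValueAt_eq_of_isArithFrobAt`), hence be trivial (tree Hecke rigidity
`eq_one_of_eventually_valueAtUniformizer_eq_one`), contradicting its NONZERO infinity type (tree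
`HasInfinityType.eq_of_isTotallyComplex`). The Theorems-side tree already holds cousins of several steps
(`UniversalToricDescentThinCombReflectedAvatar.isPAdicAvatarOf_galConj_outerConj` :89, `.galConj_absGaloisQuot_eq` :235,
`PrintCf2SplitBadTwoAvatarRigidity.isPAdicAvatarOf_unique` :139, `EisensteinPrimesTwoVariableOmegaBranchCharacters.isPAdicAvatarOf_normCharacter`
:181); they are re-derived here over Literature because a Cruxes workfile cannot import `Summits/…/Theorems` on the farm. -/

section ValueConditionsTwoThree

variable {p : ℕ} [Fact p.Prime]

/-- **PAIR DETERMINATION**: a rank-one representation through the pair `(κ₁, κ₂)` with `r(γ₁) = r(γ₂) = 1` at a generator pair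
is trivial-valued (the descended character of `ℤ_p²` is continuous, multiplicative and `1` on `ℕ²`, which is dense).
[cite: deShalit1987, II.4.17 (54) (p. 78)] [cite: Washington1997, §13.1] -/
theorem avatarValueAt_eq_one_of_generators {κ₁ κ₂ : ZpExtension K p} {γ₁ γ₂ : absoluteGaloisGroup K}
    {r : FramedGaloisRep K (PadicAlgCl p) 1} (hr : FactorsThroughPair κ₁ κ₂ r)
    (hγ : ZpExtension.IsTopGeneratorPair κ₁ κ₂ γ₁ γ₂) (h1 : avatarValueAt r γ₁ = 1) (h2 : avatarValueAt r γ₂ = 1)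
    (σ : absoluteGaloisGroup K) : avatarValueAt r σ = 1 := by
  have hind := hγ.isIndependent
  have hF := ZpExtension.isContinuousChar₂_pairChar hr hγ hind
  have hdense : DenseRange (Prod.map (Nat.cast : ℕ → ℤ_[p]) (Nat.cast : ℕ → ℤ_[p])) :=
    PadicInt.denseRange_natCast.prodMap PadicInt.denseRange_natCast
  have hconst : ZpExtension.pairChar hind r = fun _ => (1 : ℂ_[p]) := by
    refine hdense.equalizer hF.continuous continuous_const ?_
    funext ab
    obtain ⟨a, b⟩ := ab
    simp only [Function.comp_apply, Prod.map_apply]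
    rw [hF.apply_natCast, ZpExtension.pairChar_one_zero hr hγ hind, ZpExtension.pairChar_zero_one hr hγ hind,
      h1, h2, one_pow, one_pow, one_mul]
  rw [← ZpExtension.pairChar_pairCoord hind hr σ, hconst]

/-- **Trivial avatar ⇒ trivial Frobenius values**: if `r` is the avatar of `φ` and `r(σ) = 1` for all `σ`, then
`φ(ϖ_v) = 1` at every `v ∤ p` where `φ` is unramified (an arithmetic Frobenius exists above `v`).
[cite: SerreAbelianLadic1968, Ch. I §2.1, Ch. II §2.7] -/
theorem valueAtUniformizer_eq_one_of_avatar_trivial {ι : PadicAlgCl p ≃+* ℂ} {φ : HeckeCharacter K}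
    {r : FramedGaloisRep K (PadicAlgCl p) 1} (hr : IsPAdicAvatarOf ι φ r)
    (htriv : ∀ σ : absoluteGaloisGroup K, avatarValueAt r σ = 1)
    {v : HeightOneSpectrum (𝓞 K)} (hv : ((p : ℕ) : 𝓞 K) ∉ v.asIdeal) (hunr : φ.IsUnramifiedAt v) :
    φ.valueAtUniformizer v = 1 := by
  obtain ⟨𝔔, h𝔔⟩ := v.primesAbove_nonempty
  obtain ⟨σ, hσ⟩ := HeightOneSpectrum.exists_isArithFrobAt_of_mem_primesAbove_holds h𝔔
  have h := (hr.isPAdicAvatarOutside ∅).avatarValueAt_eq_of_isArithFrobAt (Finset.notMem_empty v) hv hunr h𝔔 hσ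
  rw [htriv] at h
  have h' : ((ι.symm (φ.valueAtUniformizer v))⁻¹ : PadicAlgCl p) = 1 :=
    UniformSpace.Completion.coe_injective (PadicAlgCl p) (by rw [← h, UniformSpace.Completion.coe_one])
  have h'' : ι.symm (φ.valueAtUniformizer v) = 1 := inv_eq_one.mp h'
  calc φ.valueAtUniformizer v = ι (ι.symm (φ.valueAtUniformizer v)) := (ι.apply_symm_apply _).symm
    _ = 1 := by rw [h'', map_one]

/-- **Trivial avatar ⇒ trivial character** for an everywhere-unramified `φ` (Hecke rigidity: `φ(ϖ_v) = 1` off the finitely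
many `v ∣ p`). [cite: CasselsFrohlichANT1967, Ch. VII §4 Prop. 4.1] -/
theorem eq_one_of_avatar_trivial {ι : PadicAlgCl p ≃+* ℂ} {φ : HeckeCharacter K}
    {r : FramedGaloisRep K (PadicAlgCl p) 1} (hr : IsPAdicAvatarOf ι φ r)
    (hunr : ∀ v : HeightOneSpectrum (𝓞 K), φ.IsUnramifiedAt v)
    (htriv : ∀ σ : absoluteGaloisGroup K, avatarValueAt r σ = 1) : φ = 1 := by
  refine HeckeCharacter.eq_one_of_eventually_valueAtUniformizer_eq_one ?_
  have hfin : {v : HeightOneSpectrum (𝓞 K) | ((p : ℕ) : 𝓞 K) ∈ v.asIdeal}.Finite :=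
    HeightOneSpectrum.finite_setOf_natCast_mem (Fact.out : p.Prime).ne_zero
  exact Filter.eventually_of_mem hfin.compl_mem_cofinite fun v hv =>
    valueAtUniformizer_eq_one_of_avatar_trivial hr htriv hv (hunr v)

/-- **Twist powers** (local copy of §F13's `twistPow`): `r^{⊗1} = r`, `r^{⊗(k+2)} = r^{⊗(k+1)} ⊗ det r`.
[cite: SerreAbelianLadic1968, Ch. I §2.3] -/
noncomputable def twistPow (r : FramedGaloisRep K (PadicAlgCl p) 1) : ℕ → FramedGaloisRep K (PadicAlgCl p) 1
  | 0 => r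
  | k + 1 => FramedRep.twist (twistPow r k) (detChar r)

omit [NumberField K] in
/-- `r^{⊗(k+1)}(g) = r(g)^{k+1}`. [cite: SerreAbelianLadic1968, Ch. I §2.3] -/
theorem avatarValueAt_twistPow (r : FramedGaloisRep K (PadicAlgCl p) 1) (g : absoluteGaloisGroup K) (k : ℕ) :
    avatarValueAt (twistPow r k) g = avatarValueAt r g ^ (k + 1) := by
  induction k with
  | zero => simp [twistPow]
  | succ k ih => rw [twistPow, avatarValueAt_twist_detChar, ih, ← pow_succ']

omit [NumberField K] in
/-- Twist powers stay in the `ℤ_p²`-tower. [cite: deShalit1987, II.4.17 (54) (p. 78)] -/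
theorem factorsThroughPair_twistPow {κ₁ κ₂ : ZpExtension K p} {r : FramedGaloisRep K (PadicAlgCl p) 1}
    (h : FactorsThroughPair κ₁ κ₂ r) (k : ℕ) : FactorsThroughPair κ₁ κ₂ (twistPow r k) := by
  induction k with
  | zero => simpa [twistPow] using h
  | succ k ih => exact factorsThroughPair_twist_detChar ih h

/-- `r^{⊗(k+1)}` is the avatar of `A^{k+1}`. [cite: SerreAbelianLadic1968, Ch. II §2.7] -/
theorem isPAdicAvatarOf_twistPow {ι : PadicAlgCl p ≃+* ℂ} {A : HeckeCharacter K} {r : FramedGaloisRep K (PadicAlgCl p) 1}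
    (hr : IsPAdicAvatarOf ι A r) (hunr : ∀ w : HeightOneSpectrum (𝓞 K), A.IsUnramifiedAt w) (k : ℕ) :
    IsPAdicAvatarOf ι (A ^ (k + 1)) (twistPow r k) := by
  induction k with
  | zero => simpa [twistPow] using hr
  | succ k ih =>
    rw [pow_succ', twistPow]
    exact IsPAdicAvatarOf.mul_twist ih hr fun v _ => hunr v

omit [NumberField K] in
/-- In a field, `u ≠ 0` with no power `uⁿ = 1` (`n ≥ 1`) has injective powers. [folklore] -/
theorem injective_pow_of_forall_pow_ne_one {u : ℂ_[p]} (hu : u ≠ 0) (h : ∀ n : ℕ, 0 < n → u ^ n ≠ 1) :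
    Function.Injective fun k : ℕ => u ^ k := by
  intro a b hab
  simp only at hab
  by_contra hne
  rcases Nat.lt_or_gt_of_ne hne with hlt | hlt
  · apply h (b - a) (Nat.sub_pos_of_lt hlt)
    have e : u ^ b = u ^ a * u ^ (b - a) := by rw [← pow_add, Nat.add_sub_cancel' hlt.le]
    rw [e] at hab
    exact (mul_eq_left₀ (pow_ne_zero _ hu)).mp hab.symm
  · apply h (a - b) (Nat.sub_pos_of_lt hlt)
    have e : u ^ a = u ^ b * u ^ (a - b) := by rw [← pow_add, Nat.add_sub_cancel' hlt.le]
    rw [e] at hab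
    exact (mul_eq_left₀ (pow_ne_zero _ hu)).mp hab

omit [NumberField K] in
/-- `r(g⁻¹) = r(g)⁻¹`. -/
theorem avatarValueAt_inv' (r : FramedGaloisRep K (PadicAlgCl p) 1) (g : absoluteGaloisGroup K) :
    avatarValueAt r g⁻¹ = (avatarValueAt r g)⁻¹ := by
  have h : avatarValueAt r g * avatarValueAt r g⁻¹ = 1 := by
    rw [← avatarValueAt_mul, mul_inv_cancel, avatarValueAt_one]
  exact eq_inv_of_mul_eq_one_right h

/-- Values of an avatar through the pair are nonzero (they are principal units). -/
theorem avatarValueAt_ne_zero_of_factorsThroughPair {κ₁ κ₂ : ZpExtension K p} {r : FramedGaloisRep K (PadicAlgCl p) 1}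
    (hr : FactorsThroughPair κ₁ κ₂ r) (σ : absoluteGaloisGroup K) : avatarValueAt r σ ≠ 0 := by
  intro h
  have hlt := norm_avatarValueAt_sub_one_lt_of_factorsThroughPair hr σ
  rw [h, zero_sub, norm_neg, norm_one] at hlt
  exact lt_irrefl _ hlt

/-- The trivial character has type `(0, 0)`. [folklore] -/
theorem hasInfinityType_one_zero' : (1 : HeckeCharacter K).HasInfinityType (fun _ => 0) (fun _ => 0) :=
  HeckeCharacter.IsFiniteOrder.hasInfinityType_zero (IsOfFinOrder.one : IsOfFinOrder (1 : HeckeCharacter K))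

/-- **(II)-3 IN KERNEL.** For `K` imaginary quadratic, `B` everywhere unramified of type `(b₁, b₂) ≠ (0, 0)` with avatar `rB`
through the pair and `rB(γ₁⁻¹) = 1` at a generator pair: the powers of `rB(γ₂⁻¹)` are pairwise distinct. (If `rB(γ₂⁻¹)ⁿ = 1`
then `rB^{⊗n}` — the avatar of `Bⁿ` — is `1` at `γ₁, γ₂`, hence trivial; so `Bⁿ = 1`, of type `(0,0) ≠ (n b₁, n b₂)`.)
[cite: deShalit1987, II.4.17 (54)] [cite: CasselsFrohlichANT1967, Ch. VII §4 Prop. 4.1] [cite: Weil1956, §1] -/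
theorem injective_pow_avatarValueAt_of_apply_eq_one (hK : IsImaginaryQuadratic K) {ι : PadicAlgCl p ≃+* ℂ}
    {κ₁ κ₂ : ZpExtension K p} {γ₁ γ₂ : absoluteGaloisGroup K} {B : HeckeCharacter K}
    {rB : FramedGaloisRep K (PadicAlgCl p) 1} (hrB : IsPAdicAvatarOf ι B rB) (hκB : FactorsThroughPair κ₁ κ₂ rB)
    (hunrB : ∀ w : HeightOneSpectrum (𝓞 K), B.IsUnramifiedAt w) {b₁ b₂ : ℤ}
    (htB : B.HasInfinityType (fun _ => b₁) (fun _ => b₂)) (hb : b₁ ≠ 0 ∨ b₂ ≠ 0)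
    (hγ : ZpExtension.IsTopGeneratorPair κ₁ κ₂ γ₁ γ₂) (h1 : avatarValueAt rB γ₁⁻¹ = 1) :
    Function.Injective fun k : ℕ => avatarValueAt rB γ₂⁻¹ ^ k := by
  haveI := hK.2
  have hγ₁ : avatarValueAt rB γ₁ = 1 := by
    have h := avatarValueAt_inv' rB γ₁; rw [h1] at h; exact inv_eq_one.mp h.symm
  refine injective_pow_of_forall_pow_ne_one (avatarValueAt_ne_zero_of_factorsThroughPair hκB γ₂⁻¹) fun n hn hpow => ?_
  obtain ⟨m, rfl⟩ := Nat.exists_eq_succ_of_ne_zero hn.ne'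
  -- the avatar of `B^(m+1)` is trivial at the generators
  have hγ₂ : avatarValueAt rB γ₂ ^ (m + 1) = 1 := by
    rw [avatarValueAt_inv', inv_pow] at hpow
    exact inv_eq_one.mp hpow
  have htriv : ∀ σ, avatarValueAt (twistPow rB m) σ = 1 :=
    avatarValueAt_eq_one_of_generators (factorsThroughPair_twistPow hκB m) hγ
      (by rw [avatarValueAt_twistPow, hγ₁, one_pow]) (by rw [avatarValueAt_twistPow, hγ₂])
  have hone : B ^ (m + 1) = 1 :=
    eq_one_of_avatar_trivial (isPAdicAvatarOf_twistPow hrB hunrB m) (isUnramifiedAt_pow_succ hunrB m) htriv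
  have htype := hasInfinityType_pow_succ htB m
  rw [hone] at htype
  obtain ⟨e1, e2⟩ := hasInfinityType_one_zero'.eq_of_isTotallyComplex htype
  have hm : ((m : ℤ) + 1) ≠ 0 := by positivity
  obtain ⟨w⟩ := (inferInstance : Nonempty (InfinitePlace K))
  rcases hb with hb | hb
  · exact mul_ne_zero hm hb (congrFun e1 w).symm
  · exact mul_ne_zero hm hb (congrFun e2 w).symm

/-- `K` imaginary quadratic is Galois over `ℚ` (degree 2; Mathlib `IsQuadraticExtension.isGalois`) — discharges the
`[IsGalois ℚ K]` binders below from the crux's `hK`. [folklore] -/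
theorem isGalois_of_isImaginaryQuadratic (hK : IsImaginaryQuadratic K) : IsGalois ℚ K := by
  haveI : Algebra.IsQuadraticExtension ℚ K := { finrank_eq_two' := hK.1 }
  infer_instance

/-- For `K` imaginary quadratic and `c ∉ res(Γ_K)`, `absGaloisQuot ℚ K c` is the complex conjugation of the CM field `K`
(both are the non-trivial element of the two-element group `Gal(K/ℚ)`). Literature-only re-derivation of the Theorems-side
`UniversalToricDescentThinCombReflectedAvatar.absGaloisQuot_eq_complexConj` (not importable here). [cite: Washington1997, §13.1] -/
theorem absGaloisQuot_eq_complexConj' [IsGalois ℚ K] (hK : IsImaginaryQuadratic K) {c : absoluteGaloisGroup ℚ}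
    (hc : c ∉ Set.range (absGaloisRestrict ℚ K)) :
    haveI := IsImaginaryQuadratic.isCMField hK
    absGaloisQuot ℚ K c = (IsCMField.complexConj K).restrictScalars ℚ := by
  haveI := IsImaginaryQuadratic.isCMField hK
  have hcbar : absGaloisQuot ℚ K c ≠ 1 := fun h ↦ hc ((absGaloisQuot_eq_one_iff ℚ K c).mp h)
  have hσ : (IsCMField.complexConj K).restrictScalars ℚ ≠ 1 := by
    intro h
    apply IsCMField.complexConj_ne_one K
    ext x
    have := AlgEquiv.congr_fun h x
    simpa using this
  have hcard : Fintype.card (K ≃ₐ[ℚ] K) ≤ 2 := hK.1 ▸ AlgEquiv.card_le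
  by_contra hne
  have h3 : 2 < Fintype.card (K ≃ₐ[ℚ] K) := by
    rw [← Finset.card_univ]
    exact Finset.two_lt_card_iff.mpr ⟨1, absGaloisQuot ℚ K c, (IsCMField.complexConj K).restrictScalars ℚ,
      Finset.mem_univ _, Finset.mem_univ _, Finset.mem_univ _, hcbar.symm, hσ.symm, hne⟩
  omega

/-- `ψ ∘ c̄ = ψ ∘ (complex conjugation)` as Hecke characters (`K` imaginary quadratic, `c ∉ res(Γ_K)`); re-derivation of the
Theorems-side `galConj_absGaloisQuot_eq`. [cite: Washington1997, §13.1] -/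
theorem galConj_absGaloisQuot_eq' [IsGalois ℚ K] (hK : IsImaginaryQuadratic K) {c : absoluteGaloisGroup ℚ}
    (hc : c ∉ Set.range (absGaloisRestrict ℚ K)) (ψ : HeckeCharacter K) :
    haveI := IsImaginaryQuadratic.isCMField hK
    HeckeCharacter.galConj (absGaloisQuot ℚ K c) ψ = HeckeCharacter.galConj (IsCMField.complexConj K) ψ := by
  haveI := IsImaginaryQuadratic.isCMField hK
  rw [absGaloisQuot_eq_complexConj' hK hc, HeckeCharacter.galConj_restrictScalars]

/-- The outer conjugation `θ_ρ` (`ρ ∉ res Γ_K`) preserves the joint kernel of an ADAPTED pair (`κ₁` cyclotomic: `κ₁ ∘ θ_ρ = κ₁`;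
`κ₂` anticyclotomic: `κ₂ ∘ θ_ρ = κ₂⁻¹`), so `r ∘ θ_ρ` factors through the pair when `r` does.
[cite: deShalit1987, II.4.17 (54) (p. 78)] [cite: Washington1997, §13.1] -/
theorem factorsThroughPair_outerConj [IsGalois ℚ K] {κ₁ κ₂ : ZpExtension K p} {r : FramedGaloisRep K (PadicAlgCl p) 1}
    (hr : FactorsThroughPair κ₁ κ₂ r) (hκ₁ : κ₁.IsCyclotomic) (hκ₂ : κ₂.IsAnticyclotomic)
    (ρ : absoluteGaloisGroup ℚ) (hρ : ρ ∉ Set.range (absGaloisRestrict ℚ K)) :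
    FactorsThroughPair κ₁ κ₂ (r.outerConj ρ) := by
  intro σ h1 h2
  have hτ := absGaloisRestrict_absGaloisOuterConj ℚ K ρ σ
  rw [FramedGaloisRep.outerConj_apply]
  refine hr _ ?_ ?_
  · rw [hκ₁.apply_eq_of_absGaloisRestrict_eq_conj hτ, h1]
  · rw [hκ₂ _ _ ρ hρ hτ, h2, inv_one]

/-- `r(θ_ρ γ₁) = r(γ₁)` for `r` through an adapted pair (`θ_ρ γ₁ ≡ γ₁` modulo the joint kernel: `κ₂(γ₁) = 1`).
[cite: deShalit1987, II.4.17 (54) (p. 78)] -/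
theorem avatarValueAt_absGaloisOuterConj_left [IsGalois ℚ K] {κ₁ κ₂ : ZpExtension K p} {γ₁ γ₂ : absoluteGaloisGroup K}
    {r : FramedGaloisRep K (PadicAlgCl p) 1} (hr : FactorsThroughPair κ₁ κ₂ r) (hκ₁ : κ₁.IsCyclotomic)
    (hκ₂ : κ₂.IsAnticyclotomic) (hγ : ZpExtension.IsTopGeneratorPair κ₁ κ₂ γ₁ γ₂)
    (ρ : absoluteGaloisGroup ℚ) (hρ : ρ ∉ Set.range (absGaloisRestrict ℚ K)) :
    avatarValueAt r (absGaloisOuterConj ℚ K ρ γ₁) = avatarValueAt r γ₁ := by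
  have hτ := absGaloisRestrict_absGaloisOuterConj ℚ K ρ γ₁
  have h1 : κ₁ (absGaloisOuterConj ℚ K ρ γ₁) = κ₁ γ₁ := hκ₁.apply_eq_of_absGaloisRestrict_eq_conj hτ
  have h2 : κ₂ (absGaloisOuterConj ℚ K ρ γ₁) = κ₂ γ₁ := by rw [hκ₂ _ _ ρ hρ hτ, hγ.apply_left, inv_one]
  exact ZpExtension.avatarValueAt_eq_of_pairCoord_eq hr
    (by rw [ZpExtension.pairCoord_apply, ZpExtension.pairCoord_apply, h1, h2])

/-- `r(θ_ρ γ₂) = r(γ₂⁻¹)` for `r` through an adapted pair (`θ_ρ γ₂ ≡ γ₂⁻¹` modulo the joint kernel: `κ₁(γ₂) = 1`).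
[cite: deShalit1987, II.4.17 (54) (p. 78)] -/
theorem avatarValueAt_absGaloisOuterConj_right [IsGalois ℚ K] {κ₁ κ₂ : ZpExtension K p} {γ₁ γ₂ : absoluteGaloisGroup K}
    {r : FramedGaloisRep K (PadicAlgCl p) 1} (hr : FactorsThroughPair κ₁ κ₂ r) (hκ₁ : κ₁.IsCyclotomic)
    (hκ₂ : κ₂.IsAnticyclotomic) (hγ : ZpExtension.IsTopGeneratorPair κ₁ κ₂ γ₁ γ₂)
    (ρ : absoluteGaloisGroup ℚ) (hρ : ρ ∉ Set.range (absGaloisRestrict ℚ K)) :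
    avatarValueAt r (absGaloisOuterConj ℚ K ρ γ₂) = avatarValueAt r γ₂⁻¹ := by
  have hτ := absGaloisRestrict_absGaloisOuterConj ℚ K ρ γ₂
  have h1 : κ₁ (absGaloisOuterConj ℚ K ρ γ₂) = κ₁ γ₂⁻¹ := by
    rw [hκ₁.apply_eq_of_absGaloisRestrict_eq_conj hτ, map_inv, hγ.apply_right, inv_one]
  have h2 : κ₂ (absGaloisOuterConj ℚ K ρ γ₂) = κ₂ γ₂⁻¹ := by rw [hκ₂ _ _ ρ hρ hτ, map_inv]
  exact ZpExtension.avatarValueAt_eq_of_pairCoord_eq hr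
    (by rw [ZpExtension.pairCoord_apply, ZpExtension.pairCoord_apply, h1, h2])

/-- **(II)-2 IN KERNEL.** For `K` imaginary quadratic, an ADAPTED generator pair, `ρ ∉ res Γ_K`, and `A` everywhere unramified of
type `(a₁, a₂)` with `a₁ + a₂ ≠ 0` and avatar `rA` through the pair: the powers of `rA(γ₁⁻¹)` are pairwise distinct. (Let
`C = (A ∘ ρ̄)·A`, avatar `rA ⊗ det(rA ∘ θ_ρ)`, through the pair by `factorsThroughPair_outerConj`; its values at `γ₁, γ₂` are
`rA(γ₁)²` and `rA(γ₂⁻¹)·rA(γ₂) = 1`; if `rA(γ₁)ⁿ = 1` then the avatar of `Cⁿ` is trivial, so `Cⁿ = 1`; but `A ∘ ρ̄ = A ∘ c`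
has the SWAPPED type `(a₂, a₁)`, so `Cⁿ` has type `n(a₁ + a₂)·(1, 1) ≠ (0, 0)`.) No Hodge–Tate weights, no norm character.
[cite: deShalit1987, II.4.17 (54), II.6.4] [cite: Washington1997, §13.1] [cite: CasselsFrohlichANT1967, Ch. VII §4 Prop. 4.1] -/
theorem injective_pow_avatarValueAt_inv_of_add_ne_zero (hK : IsImaginaryQuadratic K) [IsGalois ℚ K]
    {ι : PadicAlgCl p ≃+* ℂ} {κ₁ κ₂ : ZpExtension K p} {γ₁ γ₂ : absoluteGaloisGroup K} {A : HeckeCharacter K}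
    {rA : FramedGaloisRep K (PadicAlgCl p) 1} (hrA : IsPAdicAvatarOf ι A rA) (hκA : FactorsThroughPair κ₁ κ₂ rA)
    (hunrA : ∀ w : HeightOneSpectrum (𝓞 K), A.IsUnramifiedAt w) {a₁ a₂ : ℤ}
    (htA : A.HasInfinityType (fun _ => a₁) (fun _ => a₂)) (ha : a₁ + a₂ ≠ 0)
    (hκ₁ : κ₁.IsCyclotomic) (hκ₂ : κ₂.IsAnticyclotomic) (hγ : ZpExtension.IsTopGeneratorPair κ₁ κ₂ γ₁ γ₂)
    (ρ : absoluteGaloisGroup ℚ) (hρ : ρ ∉ Set.range (absGaloisRestrict ℚ K)) :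
    Function.Injective fun k : ℕ => avatarValueAt rA γ₁⁻¹ ^ k := by
  haveI := hK.2
  haveI := IsImaginaryQuadratic.isCMField hK
  refine injective_pow_of_forall_pow_ne_one (avatarValueAt_ne_zero_of_factorsThroughPair hκA γ₁⁻¹) fun n hn hpow => ?_
  obtain ⟨m, rfl⟩ := Nat.exists_eq_succ_of_ne_zero hn.ne'
  have hγ₁ : avatarValueAt rA γ₁ ^ (m + 1) = 1 := by
    rw [avatarValueAt_inv', inv_pow] at hpow
    exact inv_eq_one.mp hpow
  -- the conjugate character `A ∘ ρ̄` and its avatar `rA ∘ θ_ρ`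
  set A' := HeckeCharacter.galConj (absGaloisQuot ℚ K ρ) A with hA'
  have hunrA' : ∀ w : HeightOneSpectrum (𝓞 K), A'.IsUnramifiedAt w :=
    fun w => (HeckeCharacter.isUnramifiedAt_galConj_iff _ A w).mpr (hunrA _)
  have hrA' : IsPAdicAvatarOf ι A' (rA.outerConj ρ) := isPAdicAvatarOf_galConj_outerConj hrA ρ
  have hκA' : FactorsThroughPair κ₁ κ₂ (rA.outerConj ρ) := factorsThroughPair_outerConj hκA hκ₁ hκ₂ ρ hρ
  -- the product `C = A'·A`, avatar `rA ⊗ det (rA ∘ θ_ρ)`, through the pair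
  have hrC : IsPAdicAvatarOf ι (A' * A) (FramedRep.twist rA (detChar (rA.outerConj ρ))) :=
    IsPAdicAvatarOf.mul_twist hrA hrA' fun v _ => hunrA' v
  have hκC : FactorsThroughPair κ₁ κ₂ (FramedRep.twist rA (detChar (rA.outerConj ρ))) :=
    factorsThroughPair_twist_detChar hκA hκA'
  have hunrC : ∀ w : HeightOneSpectrum (𝓞 K), (A' * A).IsUnramifiedAt w := fun w => (hunrA' w).mul' (hunrA w)
  -- values at the generators
  have hC₁ : avatarValueAt (FramedRep.twist rA (detChar (rA.outerConj ρ))) γ₁ = avatarValueAt rA γ₁ ^ 2 := by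
    rw [avatarValueAt_twist_detChar, avatarValueAt_outerConj, avatarValueAt_absGaloisOuterConj_left hκA hκ₁ hκ₂ hγ ρ hρ, sq]
  have hC₂ : avatarValueAt (FramedRep.twist rA (detChar (rA.outerConj ρ))) γ₂ = 1 := by
    rw [avatarValueAt_twist_detChar, avatarValueAt_outerConj, avatarValueAt_absGaloisOuterConj_right hκA hκ₁ hκ₂ hγ ρ hρ,
      avatarValueAt_inv', inv_mul_cancel₀ (avatarValueAt_ne_zero_of_factorsThroughPair hκA γ₂)]
  have htriv : ∀ σ, avatarValueAt (twistPow (FramedRep.twist rA (detChar (rA.outerConj ρ))) m) σ = 1 :=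
    avatarValueAt_eq_one_of_generators (factorsThroughPair_twistPow hκC m) hγ
      (by rw [avatarValueAt_twistPow, hC₁, pow_right_comm, hγ₁, one_pow])
      (by rw [avatarValueAt_twistPow, hC₂, one_pow])
  have hone : (A' * A) ^ (m + 1) = 1 :=
    eq_one_of_avatar_trivial (isPAdicAvatarOf_twistPow hrC hunrC m) (isUnramifiedAt_pow_succ hunrC m) htriv
  -- infinity types: `A'` has the swapped type, `C^(m+1)` type `(m+1)(a₁+a₂)·(1,1)`, `1` type `(0,0)`
  have htA' : A'.HasInfinityType (fun _ => a₂) (fun _ => a₁) := by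
    rw [hA', galConj_absGaloisQuot_eq' hK hρ]
    exact htA.galConj_complexConj
  have htC : (A' * A).HasInfinityType (fun _ => a₂ + a₁) (fun _ => a₁ + a₂) := htA'.mul' htA
  have htype := hasInfinityType_pow_succ htC m
  rw [hone] at htype
  obtain ⟨e1, -⟩ := hasInfinityType_one_zero'.eq_of_isTotallyComplex htype
  have hm : ((m : ℤ) + 1) ≠ 0 := by positivity
  obtain ⟨w⟩ := (inferInstance : Nonempty (InfinitePlace K))
  exact mul_ne_zero hm (by rwa [add_comm] at ha) (congrFun e1 w).symm

/-- **THE THREE VALUE CONDITIONS (S4′) OF `rich_of_two_characters` — DISCHARGED IN KERNEL** at the crux's generator inverses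
`(g₁, g₂) := (γ₁⁻¹, γ₂⁻¹)`: for `K` imaginary quadratic, `p ≠ 2`, an ADAPTED generator pair (`κ₁` cyclotomic, `κ₂`
anticyclotomic — the crux's binders), `ρ ∉ res Γ_K`, everywhere-unramified `A` of type `(−a₁, a₂)` with `a₁ ≠ a₂` and `B` of
type `(−b₁, b₂)` with `b₂ ≥ 1` and the Hecke identity `(B ∘ ρ̄)·B = 1` (automatic for the classical witness `B = (Ψᶜ/Ψ)^M`),
avatars `rA, rB` through the pair: `rB(γ₁⁻¹) = 1`, and the powers of `rA(γ₁⁻¹)` and of `rB(γ₂⁻¹)` are injective — EXACTLY the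
binders `hB₁ hA₁ hB₂` of `SplitsliceFam.rich_of_two_characters` (v1.9 l.2452). What remains of annex §9 (vi-a) after this:
(I) the EXISTENCE of such `A, B, rA, rB` (tree producers (r1)+(r2) of annex §8) and (III′) the per-point data (S2) = SEAM 1's
level pin + the two named analytic facts (`frameAuxGrid_of_facts`). Consumer: `haveI := isGalois_of_isImaginaryQuadratic hK`.
[cite: deShalit1987, II.4.12–II.4.17, II.6.4 (p. 85)] [cite: Washington1997, §13.1] -/
theorem valueConditions_of_adaptedPair (hK : IsImaginaryQuadratic K) [IsGalois ℚ K] (hp2 : p ≠ 2)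
    {ι : PadicAlgCl p ≃+* ℂ} {κ₁ κ₂ : ZpExtension K p} {γ₁ γ₂ : absoluteGaloisGroup K} {A B : HeckeCharacter K}
    {rA rB : FramedGaloisRep K (PadicAlgCl p) 1} (hrA : IsPAdicAvatarOf ι A rA) (hrB : IsPAdicAvatarOf ι B rB)
    (hκA : FactorsThroughPair κ₁ κ₂ rA) (hκB : FactorsThroughPair κ₁ κ₂ rB)
    (hunrA : ∀ w : HeightOneSpectrum (𝓞 K), A.IsUnramifiedAt w)
    (hunrB : ∀ w : HeightOneSpectrum (𝓞 K), B.IsUnramifiedAt w)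
    {a₁ a₂ b₁ b₂ : ℕ} (hab : a₁ ≠ a₂) (hb₂ : 1 ≤ b₂)
    (htA : A.HasInfinityType (fun _ ↦ -(a₁ : ℤ)) (fun _ ↦ (a₂ : ℤ)))
    (htB : B.HasInfinityType (fun _ ↦ -(b₁ : ℤ)) (fun _ ↦ (b₂ : ℤ)))
    (hκ₁ : κ₁.IsCyclotomic) (hκ₂ : κ₂.IsAnticyclotomic) (hγ : ZpExtension.IsTopGeneratorPair κ₁ κ₂ γ₁ γ₂)
    (ρ : absoluteGaloisGroup ℚ) (hρ : ρ ∉ Set.range (absGaloisRestrict ℚ K))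
    (hB : HeckeCharacter.galConj (absGaloisQuot ℚ K ρ) B * B = 1) :
    avatarValueAt rB γ₁⁻¹ = 1 ∧ (Function.Injective fun k : ℕ => avatarValueAt rA γ₁⁻¹ ^ k) ∧
      (Function.Injective fun k : ℕ => avatarValueAt rB γ₂⁻¹ ^ k) := by
  have h1 := avatarValueAt_inv_eq_one_of_galConj_mul_self_eq_one hp2 hrB hκB hunrB hκ₁ hκ₂ hγ ρ hρ hB
  exact ⟨h1, injective_pow_avatarValueAt_inv_of_add_ne_zero hK hrA hκA hunrA htA (by omega) hκ₁ hκ₂ hγ ρ hρ,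
    injective_pow_avatarValueAt_of_apply_eq_one hK hrB hκB hunrB htB (Or.inr (by omega)) hγ h1⟩

end ValueConditionsTwoThree

end Summit.BirchSwinnertonDyer.BirchSwinnertonDyer.Cruxes.TwoVariableEulerSystemDivisibility.SplitsliceSeams
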